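import Summits.ValiantsHypothesis.ValiantsHypothesis.Theses.BarrierLever
import Summits.ValiantsHypothesis.ValiantsHypothesis.Theorems.BarrierLeverPartitionMinorsHitByVPProductStatesGeneral
import Literature.Computability.AlgebraicComplexity.DetInVP

/-!
# Route BarrierLever — item `PartitionMinorsHitByVP` (stmt-ValiantsHypothesis-19717):
# the TRANSVERSAL-MINOR (bi-affine DETERMINANTAL) door

Helper file (`--supports stmt-ValiantsHypothesis-19717`; cell valiant-natproofs, rung V4, 𝒟-side door
(c); prover seat val-np-p6 gen 7). Definition-free. Closes NO item.

In `MvPolynomial (Fin (h+h)) ℂ` write `x_i = X (castAdd h i)`, `y_j = X (natAdd h j)`. For a table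
`A : Fin h × Bool → Fin h × Bool → ℂ` (a `2h × 2h` matrix whose rows / columns come in pairs
`(i, false), (i, true)`) the **bi-affine determinantal witness** is
`f_A = det [ Σ_{(s,t) ∈ Bool²} A (i,s) (j,t) · x_i^s · y_j^t ]_{i,j < h}
     = det [ A(i,0)(j,0) + x_i A(i,1)(j,0) + y_j A(i,0)(j,1) + x_i y_j A(i,1)(j,1) ]`,
an `h × h` determinant of bi-affine forms: multilinear in `x` and in `y`, total degree `≤ 2h`, circuit
size `≤ 8(h+1)⁷ + 13 h²` (Berkowitz, tree fact `complexity_detPoly_le`, plus `complexity_aeval_le`).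

* `coeff_prodSite_perm` — coefficient of `x^U y^W` in a product of bi-affine sites with arbitrary
  coefficients (`ProductStatesC.coeff_prodStateC` of val-np-p3, pairing moved to the `x`-side).
* **`coeff_biaffineDet`** — `coeff_{x^U y^W} f_A = det [ A (i,[i ∈ U]) (j,[j ∈ W]) ]_{i,j}`: the
  partition matrix of `f_A` is the table of TRANSVERSAL `h × h` MINORS of `A` (row `i` taken from copy
  `[i ∈ U]`, column `j` from copy `[j ∈ W]`). Proof: Leibniz expansion; the term of `σ` is a product state
  with pairing `σ`, whose `x^U y^W`-coefficient is `∏_i A (σ i,[σ i ∈ U]) (i,[i ∈ W])`; resum by Leibniz.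
* `biaffineDet_mem_smallCircuits` — `f_A ∈ SmallCircuits ℂ (h+h) 9` for `h ≥ 4`.
* **`partitionMinor_hit_of_transversalMinor`** (THE DOOR) — if for the layout `(u, w)` some table `A`
  makes `det [ det [A (i,[i ∈ u k]) (j,[j ∈ w l])]_{i,j} ]_{k,l} ≠ 0`, the layout is hit in
  `SmallCircuits ℂ (h+h) 9`; and `partitionMinorsHitByVP_of_transversalMinors` — item 19717 follows
  from the eventual existence of such a table for every injective layout (hypothesis inline, no def).

Census of this seat (kit, evidence on the item): ONE random table hits every layout at `h = 3`
(12 869 pairs of equal-size set families), every pair of equal-size lower sets at `h = 4` (2 591) and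
at `h = 5`, and every tested layout up to `h = 10`, including all layouts known to defeat the additive,
product-state, Moore (char 2) and one-sided product witnesses. The matrices `M_A` are the compressions
of `Λ^h(A)` to the `2^h` transversal `h`-subsets; the family is closed under `M ↦ (⊗ g_i) M (⊗ g'_j)`,
`g_i, g'_j ∈ GL₂` (row/column operations inside a pair), which contains val-np-p1's compression moves.

WHAT THIS IS NOT: the existence of a good table for every layout (conjecture TM) is NOT proved here;
nothing on crux stmt-ValiantsHypothesis-14610 or on `VP ≠ VNP`.
-/

set_option linter.dupNamespace false

namespace Summit.ValiantsHypothesis.ValiantsHypothesis.Theorems.BarrierLever.TransversalMinor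

open Finset MvPolynomial
open Literature.Barriers.ValiantsHypothesis Literature.Computability.AlgebraicComplexity
open Summit.ValiantsHypothesis.ValiantsHypothesis.Theorems.BarrierLever.ProductStatesC
  (coeff_prodStateC totalDegree_siteC_le complexity_siteC_le)

noncomputable section

variable {h : ℕ}

/-! ## 1. Products of bi-affine sites, pairing on the `x`-side -/

/-- Coefficient of a product of bi-affine sites with the pairing on the `x`-side (reindexed
`ProductStatesC.coeff_prodStateC`): for a permutation `σ`,
`coeff_{x^U y^W} ∏_i (Σ_{s,t} c i s t · x_{σ i}^s · y_i^t) = ∏_i c i [σ i ∈ U] [i ∈ W]`. -/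
theorem coeff_prodSite_perm (c : Fin h → Bool → Bool → ℂ) (σ : Equiv.Perm (Fin h))
    (U W : Finset (Fin h)) :
    coeff (∑ a ∈ U, Finsupp.single (Fin.castAdd h a) 1 + ∑ c ∈ W, Finsupp.single (Fin.natAdd h c) 1)
      (∏ i, ∑ p : Bool × Bool, C (c i p.1 p.2) * X (Fin.castAdd h (σ i)) ^ p.1.toNat *
        X (Fin.natAdd h i) ^ p.2.toNat : MvPolynomial (Fin (h + h)) ℂ) =
      ∏ i, c i (decide (σ i ∈ U)) (decide (i ∈ W)) := by
  -- reindex `i = σ.symm a`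
  have hre : (∏ i, ∑ p : Bool × Bool, C (c i p.1 p.2) * X (Fin.castAdd h (σ i)) ^ p.1.toNat *
        X (Fin.natAdd h i) ^ p.2.toNat : MvPolynomial (Fin (h + h)) ℂ) =
      ∏ a, ∑ p : Bool × Bool, C ((fun a s t => c (σ.symm a) s t) a p.1 p.2) *
        X (Fin.castAdd h a) ^ p.1.toNat * X (Fin.natAdd h (σ.symm a)) ^ p.2.toNat :=
    Fintype.prod_equiv σ _ _ fun i => by simp only [Equiv.symm_apply_apply]
  rw [hre, coeff_prodStateC]
  exact Fintype.prod_equiv σ.symm _ _ fun a => by simp only [Equiv.apply_symm_apply]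

/-! ## 2. The bi-affine determinant and its partition coefficients -/

/-- **The partition matrix of the bi-affine determinant is the table of transversal minors**:
`coeff_{x^U y^W} det[Σ_{s,t} A (i,s) (j,t) x_i^s y_j^t]_{i,j} = det[A (i,[i∈U]) (j,[j∈W])]_{i,j}`. -/
theorem coeff_biaffineDet (A : Fin h × Bool → Fin h × Bool → ℂ) (U W : Finset (Fin h)) :
    coeff (∑ a ∈ U, Finsupp.single (Fin.castAdd h a) 1 + ∑ c ∈ W, Finsupp.single (Fin.natAdd h c) 1)
      (Matrix.of fun i j : Fin h => ∑ p : Bool × Bool, C (A (i, p.1) (j, p.2)) *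
        X (Fin.castAdd h i) ^ p.1.toNat * X (Fin.natAdd h j) ^ p.2.toNat :
          Matrix (Fin h) (Fin h) (MvPolynomial (Fin (h + h)) ℂ)).det =
      (Matrix.of fun i j : Fin h => A (i, decide (i ∈ U)) (j, decide (j ∈ W))).det := by
  rw [Matrix.det_apply', Matrix.det_apply', coeff_sum]
  refine Finset.sum_congr rfl fun σ _ => ?_
  have hC : ((Equiv.Perm.sign σ : ℤ) : MvPolynomial (Fin (h + h)) ℂ) =
      C ((Equiv.Perm.sign σ : ℤ) : ℂ) := by
    rw [map_intCast]
  rw [hC, coeff_C_mul]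
  congr 1
  simp only [Matrix.of_apply]
  exact coeff_prodSite_perm (fun i s t => A (σ i, s) (i, t)) σ U W

/-! ## 3. Degree and size of the witness -/

/-- A site has degree `≤ 2` (`ProductStatesC.totalDegree_siteC_le` with the pairing `swap i j`). -/
theorem totalDegree_site_le (A : Fin h × Bool → Fin h × Bool → ℂ) (i j : Fin h) :
    (∑ p : Bool × Bool, C (A (i, p.1) (j, p.2)) * X (Fin.castAdd h i) ^ p.1.toNat *
        X (Fin.natAdd h j) ^ p.2.toNat : MvPolynomial (Fin (h + h)) ℂ).totalDegree ≤ 2 := by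
  have key := totalDegree_siteC_le (fun _ s t => A (i, s) (j, t)) (Equiv.swap i j) i
  rwa [Equiv.swap_apply_left] at key

/-- The bi-affine determinant has degree `≤ h + h`. -/
theorem totalDegree_biaffineDet_le (A : Fin h × Bool → Fin h × Bool → ℂ) :
    (Matrix.of fun i j : Fin h => ∑ p : Bool × Bool, C (A (i, p.1) (j, p.2)) *
        X (Fin.castAdd h i) ^ p.1.toNat * X (Fin.natAdd h j) ^ p.2.toNat :
          Matrix (Fin h) (Fin h) (MvPolynomial (Fin (h + h)) ℂ)).det.totalDegree ≤ h + h := by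
  rw [Matrix.det_apply']
  refine (totalDegree_finsetSum _ _).trans (Finset.sup_le fun σ _ => ?_)
  have hC : ((Equiv.Perm.sign σ : ℤ) : MvPolynomial (Fin (h + h)) ℂ) =
      C ((Equiv.Perm.sign σ : ℤ) : ℂ) := by
    rw [map_intCast]
  rw [hC]
  calc (C ((Equiv.Perm.sign σ : ℤ) : ℂ) * ∏ i, (Matrix.of fun i j : Fin h =>
          ∑ p : Bool × Bool, C (A (i, p.1) (j, p.2)) * X (Fin.castAdd h i) ^ p.1.toNat *
            X (Fin.natAdd h j) ^ p.2.toNat) (σ i) i).totalDegree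
      ≤ (C ((Equiv.Perm.sign σ : ℤ) : ℂ) : MvPolynomial (Fin (h + h)) ℂ).totalDegree +
          (∏ i, (Matrix.of fun i j : Fin h =>
            ∑ p : Bool × Bool, C (A (i, p.1) (j, p.2)) * X (Fin.castAdd h i) ^ p.1.toNat *
              X (Fin.natAdd h j) ^ p.2.toNat) (σ i) i).totalDegree := totalDegree_mul _ _
    _ ≤ 0 + ∑ i, ((Matrix.of fun i j : Fin h =>
            ∑ p : Bool × Bool, C (A (i, p.1) (j, p.2)) * X (Fin.castAdd h i) ^ p.1.toNat *
              X (Fin.natAdd h j) ^ p.2.toNat) (σ i) i).totalDegree := by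
        gcongr
        · exact (totalDegree_C _).le
        · exact totalDegree_finsetProd _ _
    _ ≤ 0 + ∑ _i : Fin h, 2 := by
        gcongr with i _
        rw [Matrix.of_apply]
        exact totalDegree_site_le A (σ i) i
    _ = h + h := by simp; ring

/-- A site has size `≤ 12` (`ProductStatesC.complexity_siteC_le` with the pairing `swap i j`). -/
theorem complexity_site_le (A : Fin h × Bool → Fin h × Bool → ℂ) (i j : Fin h) :
    complexity (∑ p : Bool × Bool, C (A (i, p.1) (j, p.2)) * X (Fin.castAdd h i) ^ p.1.toNat *
        X (Fin.natAdd h j) ^ p.2.toNat : MvPolynomial (Fin (h + h)) ℂ) ≤ 12 := by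
  have key := complexity_siteC_le (fun _ s t => A (i, s) (j, t)) (Equiv.swap i j) i
  rwa [Equiv.swap_apply_left] at key

/-- The bi-affine determinant is a substitution instance of the generic determinant `DET_h`. -/
theorem biaffineDet_eq_aeval (A : Fin h × Bool → Fin h × Bool → ℂ) :
    (Matrix.of fun i j : Fin h => ∑ p : Bool × Bool, C (A (i, p.1) (j, p.2)) *
        X (Fin.castAdd h i) ^ p.1.toNat * X (Fin.natAdd h j) ^ p.2.toNat :
          Matrix (Fin h) (Fin h) (MvPolynomial (Fin (h + h)) ℂ)).det =
      aeval (fun q : Fin h × Fin h => (∑ p : Bool × Bool, C (A (q.1, p.1) (q.2, p.2)) *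
        X (Fin.castAdd h q.1) ^ p.1.toNat * X (Fin.natAdd h q.2) ^ p.2.toNat :
          MvPolynomial (Fin (h + h)) ℂ)) (detPoly (Fin h) ℂ) := by
  rw [detPoly, AlgHom.map_det, AlgHom.mapMatrix_apply]
  congr 1
  ext i j
  simp [Matrix.mvPolynomialX_apply]

/-- Size of the witness: `≤ 8 (h+1)⁷ + 13 h²` (Berkowitz + substitution). -/
theorem complexity_biaffineDet_le (A : Fin h × Bool → Fin h × Bool → ℂ) :
    complexity (Matrix.of fun i j : Fin h => ∑ p : Bool × Bool, C (A (i, p.1) (j, p.2)) *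
        X (Fin.castAdd h i) ^ p.1.toNat * X (Fin.natAdd h j) ^ p.2.toNat :
          Matrix (Fin h) (Fin h) (MvPolynomial (Fin (h + h)) ℂ)).det ≤
      8 * (h + 1) ^ 7 + h * h * 12 := by
  rw [biaffineDet_eq_aeval]
  refine (complexity_aeval_le _ _).trans (Nat.add_le_add (complexity_detPoly_le ℂ h) ?_)
  calc ∑ q : Fin h × Fin h, complexity (∑ p : Bool × Bool, C (A (q.1, p.1) (q.2, p.2)) *
          X (Fin.castAdd h q.1) ^ p.1.toNat * X (Fin.natAdd h q.2) ^ p.2.toNat :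
            MvPolynomial (Fin (h + h)) ℂ)
      ≤ ∑ _q : Fin h × Fin h, 12 := Finset.sum_le_sum fun q _ => complexity_site_le A q.1 q.2
    _ = h * h * 12 := by simp [Finset.card_univ]

/-- **Membership**: for `h ≥ 4` the bi-affine determinant lies in `SmallCircuits ℂ (h+h) 9`. -/
theorem biaffineDet_mem_smallCircuits (hh : 4 ≤ h) (A : Fin h × Bool → Fin h × Bool → ℂ) :
    (Matrix.of fun i j : Fin h => ∑ p : Bool × Bool, C (A (i, p.1) (j, p.2)) *
        X (Fin.castAdd h i) ^ p.1.toNat * X (Fin.natAdd h j) ^ p.2.toNat :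
          Matrix (Fin h) (Fin h) (MvPolynomial (Fin (h + h)) ℂ)).det ∈
      SmallCircuits ℂ (h + h) 9 := by
  refine ⟨totalDegree_biaffineDet_le A, (complexity_biaffineDet_le A).trans ?_⟩
  have h1 : h + 1 ≤ h + h := by omega
  have h2 : 8 * (h + 1) ^ 7 ≤ 8 * (h + h) ^ 7 := by gcongr
  have h3 : h * h * 12 ≤ 12 * (h + h) ^ 7 := by
    calc h * h * 12 = 12 * (h * h) := by ring
      _ ≤ 12 * (h + h) ^ 7 := by
          gcongr
          calc h * h ≤ (h + h) * (h + h) := by gcongr <;> omega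
            _ = (h + h) ^ 2 := by ring
            _ ≤ (h + h) ^ 7 := Nat.pow_le_pow_right (by omega) (by omega)
  have h4 : 20 ≤ (h + h) ^ 2 := by nlinarith
  calc 8 * (h + 1) ^ 7 + h * h * 12 ≤ 8 * (h + h) ^ 7 + 12 * (h + h) ^ 7 := Nat.add_le_add h2 h3
    _ = 20 * (h + h) ^ 7 := by ring
    _ ≤ (h + h) ^ 2 * (h + h) ^ 7 := Nat.mul_le_mul_right _ h4
    _ = (h + h) ^ 9 := by ring

/-! ## 4. The door -/

/-- **THE TRANSVERSAL-MINOR DOOR.** If some table `A` makes the layout determinant of the transversal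
minors `det[ det[A (i,[i ∈ u k]) (j,[j ∈ w l])]_{i,j} ]_{k,l}` nonzero, the layout `(u, w)` is hit inside
`SmallCircuits ℂ (h+h) 9` (`h ≥ 4`), namely by the bi-affine determinant `f_A`. -/
theorem partitionMinor_hit_of_transversalMinor (h : ℕ) (hh : 4 ≤ h) (r : ℕ)
    (u w : Fin r → Finset (Fin h)) (A : Fin h × Bool → Fin h × Bool → ℂ)
    (hA : (Matrix.of fun k l : Fin r =>
      (Matrix.of fun i j : Fin h => A (i, decide (i ∈ u k)) (j, decide (j ∈ w l))).det).det ≠ 0) :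
    ∃ f ∈ SmallCircuits ℂ (h + h) 9,
      (Matrix.of fun k l : Fin r => MvPolynomial.coeff
        (∑ a ∈ u k, Finsupp.single (Fin.castAdd h a) 1 +
          ∑ c ∈ w l, Finsupp.single (Fin.natAdd h c) 1) f).det ≠ 0 := by
  refine ⟨_, biaffineDet_mem_smallCircuits hh A, ?_⟩
  have hmat : (Matrix.of fun k l : Fin r => MvPolynomial.coeff
        (∑ a ∈ u k, Finsupp.single (Fin.castAdd h a) 1 +
          ∑ c ∈ w l, Finsupp.single (Fin.natAdd h c) 1)
        (Matrix.of fun i j : Fin h => ∑ p : Bool × Bool, C (A (i, p.1) (j, p.2)) *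
          X (Fin.castAdd h i) ^ p.1.toNat * X (Fin.natAdd h j) ^ p.2.toNat :
            Matrix (Fin h) (Fin h) (MvPolynomial (Fin (h + h)) ℂ)).det) =
      Matrix.of fun k l : Fin r =>
        (Matrix.of fun i j : Fin h => A (i, decide (i ∈ u k)) (j, decide (j ∈ w l))).det := by
    ext k l
    rw [Matrix.of_apply, Matrix.of_apply]
    exact coeff_biaffineDet A (u k) (w l)
  rw [hmat]
  exact hA

/-- **Item 19717 modulo conjecture TM** (transversal minors): if, eventually in `h`, every injective layout
admits a table `A` with nonzero layout determinant of transversal minors, then `PartitionMinorsHitByVP`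
(with `b = 9`). -/
theorem partitionMinorsHitByVP_of_transversalMinors (h₀ : ℕ)
    (H : ∀ h : ℕ, h₀ ≤ h → ∀ (r : ℕ) (u w : Fin r → Finset (Fin h)),
      Function.Injective u → Function.Injective w →
        ∃ A : Fin h × Bool → Fin h × Bool → ℂ, (Matrix.of fun k l : Fin r =>
          (Matrix.of fun i j : Fin h => A (i, decide (i ∈ u k)) (j, decide (j ∈ w l))).det).det ≠ 0) :
    Summit.ValiantsHypothesis.ValiantsHypothesis.Theses.BarrierLever.PartitionMinorsHitByVP := by
  refine ⟨9, max h₀ 4, fun h hh r u w hu hw => ?_⟩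
  have hh₀ : h₀ ≤ h := le_trans (le_max_left _ _) hh
  have hh4 : 4 ≤ h := le_trans (le_max_right _ _) hh
  obtain ⟨A, hA⟩ := H h hh₀ r u w hu hw
  exact partitionMinor_hit_of_transversalMinor h hh4 r u w A hA

end

end Summit.ValiantsHypothesis.ValiantsHypothesis.Theorems.BarrierLever.TransversalMinor
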